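import Summits.Ventures.YMGap.Thresholds.SharpClusteringRegionWords
import Summits.Ventures.YMGap.Thresholds.SharpClusteringWilson
import HarnessLib

/-!
# Venture YMGap — track (a), OBJECT U1, part 2/2: the TERMWISE CROSS-LINK HESSIAN BOUND for the
# DLR-kernel potential (frozen exterior): `OffDiagHessBound (regionPot E η β) (regionH N E β)`

HONEST FRAMING: venture file (cell `pub-ymgap`, track (a), seat ds-2; brick U1). Pure finite-dimensional
calculus; NO measure, NO threshold, NO uniqueness or clustering statement. Nothing about the continuum
or the mass gap.

For every finite edge set `E ⊂ E(ℤ^d)`, every exterior configuration `η`, every 't Hooft coupling `β`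
(tree coupling `Nβ`), all DISTINCT interior links `e ≠ e'` and arbitrary `X, Y ∈ M_N(ℂ)`, at every point
of `SU(N)^E`:

  `|D_{single_e X} D_{single_{e'} Y} (regionPot E η β)| ≤ regionH N E β e e' · ‖X‖_F ‖Y‖_F`,
  `regionH N E β e e' = N|β| · #{p ∈ plaquettesTouching E : e, e' ∈ plaquetteEdges p}`

(`abs_algD_lk_algD_lk_regionPot_le`; Shen–Zhu–Zhu CMP 400 (2023) (4.3) with the exterior links frozen —
they are unitary constants and do not move under the interior flows), hence the fifth binder of lit-1's
`kernel_covariance_exp_decay` ((T_E), OBJECT U2): `offDiagHessBound_regionPot (E) (η) (β) :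
OffDiagHessBound (regionPot E η β) (regionH N E β)`. NO side condition: the four links of a `ℤ^d`
plaquette are distinct (`zSlot_injective`). The other four binders (`regionH_nonneg`, `regionH_symm`,
`sum_regionH_le`, `supNorm_le_one_of_regionH_ne_zero`) are in part 1/2.

Method = the torus file `SharpClusteringWilson.lean` (imported for its word lemmas) with the readers `linkOrExt E η · (zSlot p k)` and
directions `extDir E · (zSlot p k)`: the 16-word second-derivative expansion of `W_{E,η,p}(1,1,1)`, the
unitary-point pattern bounds `|Re tr(a M b M')| ≤ ‖a‖_F‖b‖_F`, summation over `plaquettesTouching E`.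

References: H. Shen, R. Zhu, X. Zhu, CMP 400 (2023) 805–851, Lemma 4.1, (4.3), Remark 1.3.
-/

noncomputable section

open scoped Matrix ComplexConjugate BigOperators Matrix.Norms.Frobenius ContDiff Topology
open Matrix Complex Finset
open Literature.MathematicalPhysics.QuantumFieldTheory hiding ZdEdge
open Literature.MathematicalPhysics.QuantumLattice (LGConfig ZdEdge ZdPlaquette plaquetteEdges plaquettesTouching)
open Literature.MathematicalPhysics.QuantumFieldTheory.SUNBakryEmery (SUN)

namespace Summit.Ventures.YMGap

namespace SharpClustering

open LatticeBakryEmery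

variable {d N : ℕ}

/-! ### Second derivatives of the kernel plaquette term -/

/-- **Second left-invariant derivatives of the kernel plaquette term**: sixteen words (grouped by the
slot of the inner derivative `A`; `w_k`, `A_k`, `B_k` the link matrices and directions at the slots). -/
theorem algD_algD_regWord_one (E : Finset (ZdEdge d)) (η : LGConfig d (SUN N)) (p : ZdPlaquette d)
    (A B : Cfg ↥E N) :
    algD B (algD A (regWord (N := N) E η p 1 1 1)) =
      (regWord E η p (extDir E B (zSlot p 0) * extDir E A (zSlot p 0)) 1 1 +
          regWord E η p (extDir E A (zSlot p 0)) (extDir E B (zSlot p 1)) 1 +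
          regWord E η p (extDir E A (zSlot p 0)) ((extDir E B (zSlot p 2))ᴴ) 1 +
          regWord E η p (extDir E A (zSlot p 0)) 1 ((extDir E B (zSlot p 3))ᴴ)) +
      (regWord E η p (extDir E B (zSlot p 0)) (extDir E A (zSlot p 1)) 1 +
          regWord E η p 1 (extDir E B (zSlot p 1) * extDir E A (zSlot p 1)) 1 +
          regWord E η p 1 (extDir E A (zSlot p 1) * (extDir E B (zSlot p 2))ᴴ) 1 +
          regWord E η p 1 (extDir E A (zSlot p 1)) ((extDir E B (zSlot p 3))ᴴ)) +
      (regWord E η p (extDir E B (zSlot p 0)) ((extDir E A (zSlot p 2))ᴴ) 1 +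
          regWord E η p 1 (extDir E B (zSlot p 1) * (extDir E A (zSlot p 2))ᴴ) 1 +
          regWord E η p 1 ((extDir E A (zSlot p 2))ᴴ * (extDir E B (zSlot p 2))ᴴ) 1 +
          regWord E η p 1 ((extDir E A (zSlot p 2))ᴴ) ((extDir E B (zSlot p 3))ᴴ)) +
      (regWord E η p (extDir E B (zSlot p 0)) 1 ((extDir E A (zSlot p 3))ᴴ) +
          regWord E η p 1 (extDir E B (zSlot p 1)) ((extDir E A (zSlot p 3))ᴴ) +
          regWord E η p 1 ((extDir E B (zSlot p 2))ᴴ) ((extDir E A (zSlot p 3))ᴴ) +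
          regWord E η p 1 1 ((extDir E A (zSlot p 3))ᴴ * (extDir E B (zSlot p 3))ᴴ)) := by
  rw [algD_regWord]
  simp only [Matrix.mul_one, Matrix.one_mul]
  have hc := fun c₁ c₂ c₃ => contDiff_regWord (N := N) E η p c₁ c₂ c₃
  set W₁ := regWord (N := N) E η p (extDir E A (zSlot p 0)) 1 1 with hW₁
  set W₂ := regWord (N := N) E η p 1 (extDir E A (zSlot p 1)) 1 with hW₂
  set W₃ := regWord (N := N) E η p 1 ((extDir E A (zSlot p 2))ᴴ) 1 with hW₃
  set W₄ := regWord (N := N) E η p 1 1 ((extDir E A (zSlot p 3))ᴴ) with hW₄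
  have h₁ : ContDiff ℝ ∞ W₁ := hc _ _ _
  have h₂ : ContDiff ℝ ∞ W₂ := hc _ _ _
  have h₃ : ContDiff ℝ ∞ W₃ := hc _ _ _
  have h₄ : ContDiff ℝ ∞ W₄ := hc _ _ _
  have h₁₂ : ContDiff ℝ ∞ (W₁ + W₂) := h₁.add h₂
  have h₁₂₃ : ContDiff ℝ ∞ (W₁ + W₂ + W₃) := h₁₂.add h₃
  rw [algD_add h₁₂₃ h₄, algD_add h₁₂ h₃, algD_add h₁ h₂, hW₁, hW₂, hW₃, hW₄, algD_regWord, algD_regWord,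
    algD_regWord, algD_regWord]
  simp only [Matrix.mul_one, Matrix.one_mul]

/-! ### Bounds for the kernel plaquette words at points of `SU(N)^E` -/

section UnitaryPoint

variable (E : Finset (ZdEdge d)) (η : LGConfig d (SUN N)) (p : ZdPlaquette d) (g : PSU ↥E N)

/-- Pattern `(a, b, 1)`. -/
theorem abs_regWord_ab_one_le (a b : Matrix (Fin N) (Fin N) ℂ) :
    |regWord E η p a b 1 (emb g)| ≤ frobNorm a * frobNorm b := by
  simp only [regWord]
  set U0 := linkOrExt E η (emb g) (zSlot p 0)
  set U1 := linkOrExt E η (emb g) (zSlot p 1)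
  set U2 := linkOrExt E η (emb g) (zSlot p 2)
  set U3 := linkOrExt E η (emb g) (zSlot p 3)
  have hU := linkOrExt_emb_mem_unitaryGroup E η g
  have hUc : ∀ e, (linkOrExt E η (emb g) e)ᴴ ∈ Matrix.unitaryGroup (Fin N) ℂ := fun e => by
    rw [← Matrix.star_eq_conjTranspose]; exact Unitary.star_mem (hU e)
  rw [show U0 * a * U1 * b * U2ᴴ * 1 * U3ᴴ = U0 * (a * U1 * b * (U2ᴴ * U3ᴴ)) by
      simp only [Matrix.mul_one, Matrix.mul_assoc], Matrix.trace_mul_comm,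
    show a * U1 * b * (U2ᴴ * U3ᴴ) * U0 = a * U1 * b * (U2ᴴ * U3ᴴ * U0) by simp only [Matrix.mul_assoc]]
  exact abs_re_trace_word_two_le (hU _) (mul_mem (mul_mem (hUc _) (hUc _)) (hU _))

/-- Pattern `(a, 1, b)`. -/
theorem abs_regWord_a_one_b_le (a b : Matrix (Fin N) (Fin N) ℂ) :
    |regWord E η p a 1 b (emb g)| ≤ frobNorm a * frobNorm b := by
  simp only [regWord]
  set U0 := linkOrExt E η (emb g) (zSlot p 0)
  set U1 := linkOrExt E η (emb g) (zSlot p 1)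
  set U2 := linkOrExt E η (emb g) (zSlot p 2)
  set U3 := linkOrExt E η (emb g) (zSlot p 3)
  have hU := linkOrExt_emb_mem_unitaryGroup E η g
  have hUc : ∀ e, (linkOrExt E η (emb g) e)ᴴ ∈ Matrix.unitaryGroup (Fin N) ℂ := fun e => by
    rw [← Matrix.star_eq_conjTranspose]; exact Unitary.star_mem (hU e)
  rw [show U0 * a * U1 * 1 * U2ᴴ * b * U3ᴴ = U0 * (a * (U1 * U2ᴴ) * b * U3ᴴ) by
      simp only [Matrix.mul_one, Matrix.mul_assoc], Matrix.trace_mul_comm,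
    show a * (U1 * U2ᴴ) * b * U3ᴴ * U0 = a * (U1 * U2ᴴ) * b * (U3ᴴ * U0) by simp only [Matrix.mul_assoc]]
  exact abs_re_trace_word_two_le (mul_mem (hU _) (hUc _)) (mul_mem (hUc _) (hU _))

/-- Pattern `(1, a, b)`. -/
theorem abs_regWord_one_ab_le (a b : Matrix (Fin N) (Fin N) ℂ) :
    |regWord E η p 1 a b (emb g)| ≤ frobNorm a * frobNorm b := by
  simp only [regWord]
  set U0 := linkOrExt E η (emb g) (zSlot p 0)
  set U1 := linkOrExt E η (emb g) (zSlot p 1)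
  set U2 := linkOrExt E η (emb g) (zSlot p 2)
  set U3 := linkOrExt E η (emb g) (zSlot p 3)
  have hU := linkOrExt_emb_mem_unitaryGroup E η g
  have hUc : ∀ e, (linkOrExt E η (emb g) e)ᴴ ∈ Matrix.unitaryGroup (Fin N) ℂ := fun e => by
    rw [← Matrix.star_eq_conjTranspose]; exact Unitary.star_mem (hU e)
  rw [show U0 * 1 * U1 * a * U2ᴴ * b * U3ᴴ = U0 * U1 * (a * U2ᴴ * b * U3ᴴ) by
      simp only [Matrix.mul_one, Matrix.mul_assoc], Matrix.trace_mul_comm,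
    show a * U2ᴴ * b * U3ᴴ * (U0 * U1) = a * U2ᴴ * b * (U3ᴴ * (U0 * U1)) by simp only [Matrix.mul_assoc]]
  exact abs_re_trace_word_two_le (hUc _) (mul_mem (hUc _) (mul_mem (hU _) (hU _)))

/-- Pattern `(a·b, 1, 1)`. -/
theorem abs_regWord_mul_one_one_le (a b : Matrix (Fin N) (Fin N) ℂ) :
    |regWord E η p (a * b) 1 1 (emb g)| ≤ frobNorm a * frobNorm b := by
  simp only [regWord]
  set U0 := linkOrExt E η (emb g) (zSlot p 0)
  set U1 := linkOrExt E η (emb g) (zSlot p 1)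
  set U2 := linkOrExt E η (emb g) (zSlot p 2)
  set U3 := linkOrExt E η (emb g) (zSlot p 3)
  have hU := linkOrExt_emb_mem_unitaryGroup E η g
  have hUc : ∀ e, (linkOrExt E η (emb g) e)ᴴ ∈ Matrix.unitaryGroup (Fin N) ℂ := fun e => by
    rw [← Matrix.star_eq_conjTranspose]; exact Unitary.star_mem (hU e)
  rw [show U0 * (a * b) * U1 * 1 * U2ᴴ * 1 * U3ᴴ = U0 * (a * 1 * b * (U1 * U2ᴴ * U3ᴴ)) by
      simp only [Matrix.mul_one, Matrix.mul_assoc], Matrix.trace_mul_comm,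
    show a * 1 * b * (U1 * U2ᴴ * U3ᴴ) * U0 = a * 1 * b * (U1 * U2ᴴ * U3ᴴ * U0) by simp only [Matrix.mul_assoc]]
  exact abs_re_trace_word_two_le (one_mem _)
    (mul_mem (mul_mem (mul_mem (hU _) (hUc _)) (hUc _)) (hU _))

/-- Pattern `(1, a·b, 1)`. -/
theorem abs_regWord_one_mul_one_le (a b : Matrix (Fin N) (Fin N) ℂ) :
    |regWord E η p 1 (a * b) 1 (emb g)| ≤ frobNorm a * frobNorm b := by
  simp only [regWord]
  set U0 := linkOrExt E η (emb g) (zSlot p 0)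
  set U1 := linkOrExt E η (emb g) (zSlot p 1)
  set U2 := linkOrExt E η (emb g) (zSlot p 2)
  set U3 := linkOrExt E η (emb g) (zSlot p 3)
  have hU := linkOrExt_emb_mem_unitaryGroup E η g
  have hUc : ∀ e, (linkOrExt E η (emb g) e)ᴴ ∈ Matrix.unitaryGroup (Fin N) ℂ := fun e => by
    rw [← Matrix.star_eq_conjTranspose]; exact Unitary.star_mem (hU e)
  rw [show U0 * 1 * U1 * (a * b) * U2ᴴ * 1 * U3ᴴ = U0 * U1 * (a * 1 * b * (U2ᴴ * U3ᴴ)) by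
      simp only [Matrix.mul_one, Matrix.mul_assoc], Matrix.trace_mul_comm,
    show a * 1 * b * (U2ᴴ * U3ᴴ) * (U0 * U1) = a * 1 * b * (U2ᴴ * U3ᴴ * (U0 * U1)) by
      simp only [Matrix.mul_assoc]]
  exact abs_re_trace_word_two_le (one_mem _)
    (mul_mem (mul_mem (hUc _) (hUc _)) (mul_mem (hU _) (hU _)))

/-- Pattern `(1, 1, a·b)`. -/
theorem abs_regWord_one_one_mul_le (a b : Matrix (Fin N) (Fin N) ℂ) :
    |regWord E η p 1 1 (a * b) (emb g)| ≤ frobNorm a * frobNorm b := by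
  simp only [regWord]
  set U0 := linkOrExt E η (emb g) (zSlot p 0)
  set U1 := linkOrExt E η (emb g) (zSlot p 1)
  set U2 := linkOrExt E η (emb g) (zSlot p 2)
  set U3 := linkOrExt E η (emb g) (zSlot p 3)
  have hU := linkOrExt_emb_mem_unitaryGroup E η g
  have hUc : ∀ e, (linkOrExt E η (emb g) e)ᴴ ∈ Matrix.unitaryGroup (Fin N) ℂ := fun e => by
    rw [← Matrix.star_eq_conjTranspose]; exact Unitary.star_mem (hU e)
  rw [show U0 * 1 * U1 * 1 * U2ᴴ * (a * b) * U3ᴴ = U0 * U1 * U2ᴴ * (a * 1 * b * U3ᴴ) by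
      simp only [Matrix.mul_one, Matrix.mul_assoc], Matrix.trace_mul_comm,
    show a * 1 * b * U3ᴴ * (U0 * U1 * U2ᴴ) = a * 1 * b * (U3ᴴ * (U0 * U1 * U2ᴴ)) by
      simp only [Matrix.mul_assoc]]
  exact abs_re_trace_word_two_le (one_mem _)
    (mul_mem (hUc _) (mul_mem (mul_mem (hU _) (hU _)) (hUc _)))

/-- **The mixed second derivative of one kernel plaquette term at a point of `SU(N)^E`**:
`|D_B D_A W_{E,η,p}(1,1,1)(Q)| ≤ (Σ_j ‖B_j‖_F)(Σ_k ‖A_k‖_F)`, `A_k = extDir E A (zSlot p k)`. -/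
theorem abs_algD_algD_regWord_le (A B : Cfg ↥E N) :
    |algD B (algD A (regWord (N := N) E η p 1 1 1)) (emb g)| ≤
      (frobNorm (extDir E B (zSlot p 0)) + frobNorm (extDir E B (zSlot p 1)) + frobNorm (extDir E B (zSlot p 2)) +
          frobNorm (extDir E B (zSlot p 3))) *
        (frobNorm (extDir E A (zSlot p 0)) + frobNorm (extDir E A (zSlot p 1)) + frobNorm (extDir E A (zSlot p 2)) +
          frobNorm (extDir E A (zSlot p 3))) := by
  rw [algD_algD_regWord_one]
  simp only [Pi.add_apply]
  have t11 := abs_regWord_mul_one_one_le E η p g (extDir E B (zSlot p 0)) (extDir E A (zSlot p 0))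
  have t12 := abs_regWord_ab_one_le E η p g (extDir E A (zSlot p 0)) (extDir E B (zSlot p 1))
  have t13 := abs_regWord_ab_one_le E η p g (extDir E A (zSlot p 0)) ((extDir E B (zSlot p 2))ᴴ)
  have t14 := abs_regWord_a_one_b_le E η p g (extDir E A (zSlot p 0)) ((extDir E B (zSlot p 3))ᴴ)
  have t21 := abs_regWord_ab_one_le E η p g (extDir E B (zSlot p 0)) (extDir E A (zSlot p 1))
  have t22 := abs_regWord_one_mul_one_le E η p g (extDir E B (zSlot p 1)) (extDir E A (zSlot p 1))
  have t23 := abs_regWord_one_mul_one_le E η p g (extDir E A (zSlot p 1)) ((extDir E B (zSlot p 2))ᴴ)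
  have t24 := abs_regWord_one_ab_le E η p g (extDir E A (zSlot p 1)) ((extDir E B (zSlot p 3))ᴴ)
  have t31 := abs_regWord_ab_one_le E η p g (extDir E B (zSlot p 0)) ((extDir E A (zSlot p 2))ᴴ)
  have t32 := abs_regWord_one_mul_one_le E η p g (extDir E B (zSlot p 1)) ((extDir E A (zSlot p 2))ᴴ)
  have t33 := abs_regWord_one_mul_one_le E η p g ((extDir E A (zSlot p 2))ᴴ) ((extDir E B (zSlot p 2))ᴴ)
  have t34 := abs_regWord_one_ab_le E η p g ((extDir E A (zSlot p 2))ᴴ) ((extDir E B (zSlot p 3))ᴴ)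
  have t41 := abs_regWord_a_one_b_le E η p g (extDir E B (zSlot p 0)) ((extDir E A (zSlot p 3))ᴴ)
  have t42 := abs_regWord_one_ab_le E η p g (extDir E B (zSlot p 1)) ((extDir E A (zSlot p 3))ᴴ)
  have t43 := abs_regWord_one_ab_le E η p g ((extDir E B (zSlot p 2))ᴴ) ((extDir E A (zSlot p 3))ᴴ)
  have t44 := abs_regWord_one_one_mul_le E η p g ((extDir E A (zSlot p 3))ᴴ) ((extDir E B (zSlot p 3))ᴴ)
  refine (abs_add_four_le (abs_add_four_le t11 t12 t13 t14) (abs_add_four_le t21 t22 t23 t24)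
    (abs_add_four_le t31 t32 t33 t34) (abs_add_four_le t41 t42 t43 t44)).trans (le_of_eq ?_)
  simp only [frobNorm_conjTranspose]
  ring

end UnitaryPoint

/-! ### The termwise cross-link Hessian bound for the kernel potential -/

section Main

variable {E : Finset (ZdEdge d)}

/-- `Σ_j ‖(extDir E (single_e X))(zSlot p j)‖_F = slotCount p e · ‖X‖_F`. -/
theorem sum_frobNorm_extDir_lk (p : ZdPlaquette d) (e : ↥E) (X : Matrix (Fin N) (Fin N) ℂ) :
    frobNorm (extDir E (lk (ι := ↥E) e X) (zSlot p 0)) + frobNorm (extDir E (lk (ι := ↥E) e X) (zSlot p 1)) +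
        frobNorm (extDir E (lk (ι := ↥E) e X) (zSlot p 2)) + frobNorm (extDir E (lk (ι := ↥E) e X) (zSlot p 3)) =
      (slotCount p (e : ZdEdge d) : ℝ) * frobNorm X := by
  classical
  have h : ∀ e' : ZdEdge d, frobNorm (extDir E (lk (ι := ↥E) e X) e') =
      if e' = (e : ZdEdge d) then frobNorm X else 0 := fun e' => by
    rw [extDir_lk]; split_ifs
    · rfl
    · exact frobNorm_zero
  simp only [h]
  rw [slotCount, Finset.card_filter, Fin.sum_univ_four]
  push_cast
  split_ifs <;> ring

/-- **Termwise cross-link Hessian bound for the DLR-kernel potential (Shen–Zhu–Zhu (4.3), frozen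
exterior).** For distinct interior links `e ≠ e'`, arbitrary `X, Y ∈ M_N(ℂ)` and every `Q ∈ SU(N)^E`:
`|D_{single_e X} D_{single_{e'} Y} (regionPot E η β)(Q)| ≤ regionH N E β e e' · ‖X‖_F ‖Y‖_F`. -/
theorem abs_algD_lk_algD_lk_regionPot_le (η : LGConfig d (SUN N)) (β : ℝ) (g : PSU ↥E N) {e e' : ↥E}
    (hne : e ≠ e') (X Y : Matrix (Fin N) (Fin N) ℂ) :
    |algD (lk e X) (algD (lk e' Y) (regionPot E η β)) (emb g)| ≤ regionH N E β e e' * frobNorm X * frobNorm Y := by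
  classical
  have hc0 : ContDiff ℝ ∞ (regionPot₀ (N := N) E η) := contDiff_of_mem_polySpace (regionPot₀_mem_polySpace E η)
  have hW : ∀ p : ZdPlaquette d, ContDiff ℝ ∞ (regWord (N := N) E η p 1 1 1) := fun p => contDiff_regWord E η p 1 1 1
  have hpot : regionPot (N := N) E η β = fun Q => (N : ℝ) * β * regionPot₀ E η Q := rfl
  have key : algD (lk e X) (algD (lk e' Y) (regionPot E η β)) = fun Q =>
      (N : ℝ) * β * ∑ p ∈ plaquettesTouching E, algD (lk e X) (algD (lk e' Y) (regWord E η p 1 1 1)) Q := by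
    rw [hpot, algD_const_mul hc0, algD_const_mul (contDiff_algD hc0 _), regionPot₀_eq_sum_regWord,
      algD_sum (plaquettesTouching E) (F := fun p => regWord (N := N) E η p 1 1 1) (fun p _ => hW p),
      algD_sum (plaquettesTouching E) (F := fun p => algD (lk e' Y) (regWord (N := N) E η p 1 1 1))
        (fun p _ => contDiff_algD (hW p) _)]
  rw [key]
  simp only
  have hX := frobNorm_nonneg X
  have hY := frobNorm_nonneg Y
  have hterm : ∀ p : ZdPlaquette d,
      |algD (lk e X) (algD (lk e' Y) (regWord (N := N) E η p 1 1 1)) (emb g)| ≤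
        ((slotCount p (e : ZdEdge d) * slotCount p (e' : ZdEdge d) : ℕ) : ℝ) * (frobNorm X * frobNorm Y) :=
    fun p => by
    refine (abs_algD_algD_regWord_le E η p g (lk e' Y) (lk e X)).trans (le_of_eq ?_)
    rw [sum_frobNorm_extDir_lk, sum_frobNorm_extDir_lk]
    push_cast
    ring
  have hsum : |∑ p ∈ plaquettesTouching E, algD (lk e X) (algD (lk e' Y) (regWord (N := N) E η p 1 1 1)) (emb g)| ≤
      (zJoint E e e' : ℝ) * (frobNorm X * frobNorm Y) := by
    refine (Finset.abs_sum_le_sum_abs _ _).trans ((Finset.sum_le_sum fun p _ => hterm p).trans (le_of_eq ?_))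
    rw [← Finset.sum_mul, ← sum_slotCount_mul_eq_zJoint E e e']
    push_cast
    rfl
  rw [abs_mul, abs_mul, Nat.abs_cast, regionH, if_neg hne]
  calc (N : ℝ) * |β| * |∑ p ∈ plaquettesTouching E, algD (lk e X) (algD (lk e' Y) (regWord (N := N) E η p 1 1 1)) (emb g)|
      ≤ (N : ℝ) * |β| * ((zJoint E e e' : ℝ) * (frobNorm X * frobNorm Y)) :=
        mul_le_mul_of_nonneg_left hsum (by positivity)
    _ = (N : ℝ) * |β| * zJoint E e e' * frobNorm X * frobNorm Y := by ring

/-- **(U1) The kernel instance of `OffDiagHessBound`** — the fifth binder of lit-1's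
`kernel_covariance_exp_decay` (OBJECT U2): for every finite edge set `E`, exterior configuration `η`
and 't Hooft coupling `β`, `OffDiagHessBound (regionPot E η β) (regionH N E β)`. -/
theorem offDiagHessBound_regionPot (E : Finset (ZdEdge d)) (η : LGConfig d (SUN N)) (β : ℝ) :
    OffDiagHessBound (regionPot (N := N) E η β) (regionH N E β) :=
  fun g _ _ hne X Y _ _ _ _ => abs_algD_lk_algD_lk_regionPot_le η β g hne X Y

end Main

end SharpClustering

end Summit.Ventures.YMGap
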